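import Summits.HodgeConjecture.HodgeConjecture.Theorems.F0P6aImgSectionKill
import HarnessLib

/-!
# `F0P6aImgSectionRowUp` — ★ RE-HOME of `Lines/F0_P6a_ImgSection.lean` (tree sha16 bfb84779d70f88f8, 943 l.), PART 2 of 4 — tree lines :281–:588
See PART 1 `Theorems/F0P6aImgSectionKill.lean` for the full ★ re-home header and the original module docstring (verbatim there).  Same namespace (every
fully-qualified name unchanged); the scopes open at the cut are re-opened below with their `variable` ∕ `open` ∕ `set_option` ∕ `universe` lines replayed verbatim
from the tree, in order; the code after the replay block is the tree bytes :281–:588, untouched.  HC_CM is proved only modulo the 7 printed citations (2 remaining: hLiu418 = stmt-HodgeConjecture-24832, h413 = stmt-HodgeConjecture-24833) until rung 0 closes; a re-home is count-neutral.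
-/

-- ── replay of the scopes open at tree line :281 (verbatim) ──
set_option autoImplicit false
set_option linter.dupNamespace false
noncomputable section
namespace Summit.HodgeConjecture.HodgeConjecture.Cruxes.HLiu418.F0P6aLineSpecialisation
open CategoryTheory CategoryTheory.Limits NumberField IsDedekindDomain MulAction AlgebraicGeometry
open scoped Matrix Polynomial Pointwise MonoidalCategory
open Literature.NumberTheory.GaloisRepresentations
open Literature.NumberTheory.Automorphic Literature.NumberTheory.Automorphic.UnitaryGroup
open Literature.AlgebraicGeometry.ShimuraVarieties.UnitaryCanonicalModel
open Literature.NumberTheory.Automorphic.Liu2021.AppendixC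
open Literature.AlgebraicGeometry.Motives (AlgPoints IntegralModel SchemeOver thickening thickeningGalAction thickeningLift specOver extendPoint
  specValuationSubring specFractionFieldι specRingHomι)
open Literature.NumberTheory.DiophantineGeometry (geomResidueField specialFibreFunctor specResidueField geomClosedPointIsoSpecResidueField
  geomResidueFieldEquiv toClosureValuationSubring)
open Literature.AlgebraicGeometry.RelativeSpec (ActionOver)
open Literature.NumberTheory.EllipticCurves (genericFibre specGenericPoint)
open Literature.AlgebraicGeometry.AbelianSchemes Literature.AlgebraicGeometry.AbelianSchemes.AbelianSchemeOver
open Literature.AlgebraicGeometry.GroupSchemes.AffineGroupScheme (Alg)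
open Summit.HodgeConjecture.HodgeConjecture.Cruxes.HLiu418.F0P6aModuliDatumDefs
open Summit.HodgeConjecture.HodgeConjecture.Cruxes.HLiu418.F0P6aRGDAssembly
open Summit.HodgeConjecture.HodgeConjecture.Cruxes.HLiu418.F0P6aDatumOfInputs
section KillEngine
set_option synthInstance.maxHeartbeats 100000
open Literature.AlgebraicGeometry.GroupSchemes (GroupSchemeKernel.ker GroupSchemeKernel.kerι GroupSchemeKernel.kerLift GroupSchemeKernel.kerLift_ι
  GroupSchemeKernel.kerι_comp GroupSchemeKernel.isClosedImmersion_kerι_left_of_isSeparated)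
open Literature.AlgebraicGeometry.GroupSchemes.AffineGroupScheme (quotIncl ptEquiv spI exists_comp_quotIncl_eq_of_le_ker exists_hom_comp_eq_quotIncl_of_forall
  ptEquiv_quotIncl pullback_map_quotIncl_sat_comp_eq_one quotIncl_spI_comp_eq_one_of_pullback_map flat_specOver_quotient_sat_hom algBaseChangeEquiv)
variable {F : Type} [Field F] [NumberField F] [IsCMField F] {ι₁ : F →+* ℂ}
    {Jstar : Matrix (Fin 2) (Fin 2) F}
    {K₀ : C5.OpenCompactSubgroup ↥(finAdelic ↥(maximalRealSubfield F) F (IsCMField.complexConj F) 2 Jstar)}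
    {S : RecordSystemGS F Jstar ι₁ K₀} {hU7ₛ : S.HeckeTranslateDefinedOver}
    {hJ : (Jstar.map (IsCMField.complexConj F))ᵀ = Jstar} {hJu : IsUnit Jstar}
    {Fi : Type} [Field Fi] [Algebra F Fi] {Kc : C5.SmallLevel K₀} {G : Type} [Group G]
    {𝓜 : IntegralModel (𝓞 F) F ((thickening F Fi).obj (S.M.obj Kc))}
    {w : HeightOneSpectrum (𝓞 F)} {hw : (IsCMField.complexConj F) • w ≠ w} {h𝓨 : (𝓜.localise w).IsSmoothProper 1}
    {θ : ActionOver (𝓜.localise w).total.hom ((Fi ≃ₐ[F] Fi) × G)}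
    {e : Fi →ₐ[F] AlgebraicClosure (w.adicCompletion F)}
variable (I : RGDInputsAt F ι₁ Jstar K₀ S hU7ₛ hJ hJu Fi Kc G 𝓜 w hw h𝓨 θ e)

/-! ### HEAD (statement-first) -/

set_option maxHeartbeats 400000 in
open scoped MonObj CategoryTheory.Obj in
set_option backward.isDefEq.respectTransparency false in
/-- **(ρ1𝒞) (IMG) ROW DOWNSTAIRS — `himg` AT `H″ := spGeoOf I 𝔡 y″ Lb` FROM THE (IMG-gen) ROW.**  Let `A_y —q→ B ←c— A_{y″}` be the roof legs, `Lb : LineOf I y″` the image line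
(§ Jφ), `ψ : A_{x̄} → 𝒞_{x̄″}` ANY morphism satisfying the (IMG-gen) row of ★ `exists_roofLeg_specialFibre_of_downstairsDual_kerRows_image` for `(q, c)` ((b″) text, `cbar := c̄_{x̄″}`
the special fibre of the Serre cover leg).  ASSUME (F1) `hσΩ hσκ hσΩ'' hσκ''` (the CHOSEN presentation isos are the three-piece ones, at `y` and `y″`), the UPSTAIRS factorisation
`himgΩ` of `layerΩ I y ↪ A_y —q→ B` through `V(eL Lb) ↪ layerΩ I y″ ↪ A_{y″} —c→ B`, and `hclosed`: `V((eL Lb)^sat) ↪ layerR I y″ ↪ famOf I y″ —c̄_R→ 𝒞_x̃″` is a closed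
immersion.  THEN for every `T`-point `t` of the dock `G₀(x̄)` there is `s : T → V(H″)` with `s ≫ V(H″) ↪ G₀(x̄″) ↪ A_{x̄″} —c̄_{x̄″}→ = t ≫ G₀(x̄) ↪ A_{x̄} —ψ→`.
[cite: Liu2021, Prop. D.8 (2) p. 135, p. 137] [cite: SerreTate1968, §1 Lemma 2] [cite: EGAIV2, Prop. 2.8.5] [cite: BoschLutkebohmertRaynaud1990, §2.5 Prop. 2] -/
theorem himg_spGeoOf_of_imgLine [ExpChar (geomResidueField w) I.pChar] (𝔡 : ∀ xbar, DockAt I xbar)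
    (y y'' : AlgPoints (S.M.obj Kc) (AlgebraicClosure (w.adicCompletion F))) (Lb : LineOf I y'')
    {B : AbelianSchemeOver (Spec (.of (AlgebraicClosure (w.adicCompletion F))))}
    (q : (schΩOf S Kc 𝓜 w e I.univ y).X ⟶ B.X) [IsMonHom q] (c : (schΩOf S Kc 𝓜 w e I.univ y'').X ⟶ B.X) [IsMonHom c]
    -- downstairs: `ψ` the reduced leg and `cbar` (in (ρ1𝒞): `c̄_{x̄″} = ψ_P ×_𝓨 𝓨_s ×_{𝓨_s} x̄″`) into ANY `M`; `cR` (in (ρ1𝒞): `ψ_P ×_𝓨 x̃″`) the model morphism of the side condition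
    {M : SchemeOver (geomResidueField w)}
    (ψ : (sch₀Of 𝓜 w I.univ (red₀Of S Kc 𝓜 w h𝓨 e y)).X ⟶ M) (cbar : (sch₀Of 𝓜 w I.univ (red₀Of S Kc 𝓜 w h𝓨 e y'')).X ⟶ M)
    {WR : Over (Spec (.of ↥(closureValuationSubring (w.adicCompletion F))))} (cR : (famOf I y'').X ⟶ WR)
    -- (F1) at `y` (KILL engine 0f1eef43 binder texts VERBATIM)
    (hσΩ : (isoGenericOf I y).inv =
      (I.univ.fibreBaseChangeIso ((𝓜.localise w).genericIso'.inv.left ≫ pullback.fst (𝓜.localise w).total.hom (specGenericPoint (HeightOneSpectrum.valuationSubringAtPrime F w) F))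
          (thickeningLift e (S.M.obj Kc) y).left ≪≫
        I.univ.fibreCongrPtIso (left_thickeningLift_comp_genericι_eq S Kc 𝓜 w h𝓨 e y) ≪≫
        (I.univ.fibreBaseChangeIso (liftOf S Kc 𝓜 w h𝓨 e y).left (sΩ w)).symm).inv.hom.hom.hom)
    (hσκ : (isoSpecialOf I y).inv =
      (I.univ.fibreBaseChangeIso (pullback.fst (𝓜.localise w).total.hom (specResidueField w)) (red₀Of S Kc 𝓜 w h𝓨 e y).left ≪≫
        I.univ.fibreCongrPtIso (left_red₀Of_comp_specialι_eq S Kc 𝓜 w h𝓨 e y) ≪≫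
        (I.univ.fibreBaseChangeIso (liftOf S Kc 𝓜 w h𝓨 e y).left (sκ w)).symm).inv.hom.hom.hom)
    -- (F1) at `y″`
    (hσΩ'' : (isoGenericOf I y'').inv =
      (I.univ.fibreBaseChangeIso ((𝓜.localise w).genericIso'.inv.left ≫ pullback.fst (𝓜.localise w).total.hom (specGenericPoint (HeightOneSpectrum.valuationSubringAtPrime F w) F))
          (thickeningLift e (S.M.obj Kc) y'').left ≪≫
        I.univ.fibreCongrPtIso (left_thickeningLift_comp_genericι_eq S Kc 𝓜 w h𝓨 e y'') ≪≫
        (I.univ.fibreBaseChangeIso (liftOf S Kc 𝓜 w h𝓨 e y'').left (sΩ w)).symm).inv.hom.hom.hom)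
    (hσκ'' : (isoSpecialOf I y'').inv =
      (I.univ.fibreBaseChangeIso (pullback.fst (𝓜.localise w).total.hom (specResidueField w)) (red₀Of S Kc 𝓜 w h𝓨 e y'').left ≪≫
        I.univ.fibreCongrPtIso (left_red₀Of_comp_specialι_eq S Kc 𝓜 w h𝓨 e y'') ≪≫
        (I.univ.fibreBaseChangeIso (liftOf S Kc 𝓜 w h𝓨 e y'').left (sκ w)).symm).inv.hom.hom.hom)
    -- the (IMG-gen) row of ★ `exists_roofLeg_specialFibre_of_downstairsDual_kerRows_image` for `ψ` ((b″) `exists_roofLeg_of_legs_kerRows_image` text VERBATIM)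
    (hIMG : haveI : IsProper (𝓜.localise w).total.hom := h𝓨.2
      (∀ (𝒦 : Over (Spec (.of (closureValuationSubring (w.adicCompletion F))))) (incl : 𝒦 ⟶ (I.univ.baseChange (extendPoint (closureValuationSubring (w.adicCompletion F)) (toClosureValuationSubring w) (𝓜.localise w).total ((𝓜.localise w).modelPointsEquiv.symm (thickeningLift e (S.M.obj Kc) y))).left).X) [Flat 𝒦.hom]
        (𝒵 : Over (Spec (.of (closureValuationSubring (w.adicCompletion F))))) (ζ : 𝒵 ⟶ (I.univ.baseChange (extendPoint (closureValuationSubring (w.adicCompletion F)) (toClosureValuationSubring w) (𝓜.localise w).total ((𝓜.localise w).modelPointsEquiv.symm (thickeningLift e (S.M.obj Kc) y''))).left).X) [IsClosedImmersion (ζ ≫ cR).left],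
        (∃ m : (Over.pullback (specFractionFieldι (closureValuationSubring (w.adicCompletion F)) (toClosureValuationSubring w)).left).obj 𝒦 ⟶ (Over.pullback (specFractionFieldι (closureValuationSubring (w.adicCompletion F)) (toClosureValuationSubring w)).left).obj 𝒵,
          m ≫ (((Over.pullback (specFractionFieldι (closureValuationSubring (w.adicCompletion F)) (toClosureValuationSubring w)).left).map ζ ≫ (I.univ.fibreBaseChangeIso ((𝓜.localise w).genericIso'.inv.left ≫ pullback.fst (𝓜.localise w).total.hom (specGenericPoint (HeightOneSpectrum.valuationSubringAtPrime F w) F)) (thickeningLift e (S.M.obj Kc) y'').left ≪≫ I.univ.fibreCongrPtIso ((𝓜.localise w).left_specFractionFieldι_comp_extendPoint_modelPointsEquiv_symm (thickeningLift e (S.M.obj Kc) y'')).symm ≪≫ (I.univ.fibreBaseChangeIso (extendPoint (closureValuationSubring (w.adicCompletion F)) (toClosureValuationSubring w) (𝓜.localise w).total ((𝓜.localise w).modelPointsEquiv.symm (thickeningLift e (S.M.obj Kc) y''))).left (specFractionFieldι (closureValuationSubring (w.adicCompletion F)) (toClosureValuationSubring w)).left).symm).inv.hom.hom.hom) ≫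 c) =
            ((Over.pullback (specFractionFieldι (closureValuationSubring (w.adicCompletion F)) (toClosureValuationSubring w)).left).map incl ≫ (I.univ.fibreBaseChangeIso ((𝓜.localise w).genericIso'.inv.left ≫ pullback.fst (𝓜.localise w).total.hom (specGenericPoint (HeightOneSpectrum.valuationSubringAtPrime F w) F)) (thickeningLift e (S.M.obj Kc) y).left ≪≫ I.univ.fibreCongrPtIso ((𝓜.localise w).left_specFractionFieldι_comp_extendPoint_modelPointsEquiv_symm (thickeningLift e (S.M.obj Kc) y)).symm ≪≫ (I.univ.fibreBaseChangeIso (extendPoint (closureValuationSubring (w.adicCompletion F)) (toClosureValuationSubring w) (𝓜.localise w).total ((𝓜.localise w).modelPointsEquiv.symm (thickeningLift e (S.M.obj Kc) y))).left (specFractionFieldι (closureValuationSubring (w.adicCompletion F)) (toClosureValuationSubring w)).left).symm).inv.hom.hom.hom) ≫ q) →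
        ∃ m : (Over.pullback ((geomClosedPointIsoSpecResidueField w).inv.left ≫ (specRingHomι (closureValuationSubring (w.adicCompletion F)) (toClosureValuationSubring w) (IsLocalRing.residue (closureValuationSubring (w.adicCompletion F)))).left)).obj 𝒦 ⟶ (Over.pullback ((geomClosedPointIsoSpecResidueField w).inv.left ≫ (specRingHomι (closureValuationSubring (w.adicCompletion F)) (toClosureValuationSubring w) (IsLocalRing.residue (closureValuationSubring (w.adicCompletion F)))).left)).obj 𝒵,
          m ≫ (((Over.pullback ((geomClosedPointIsoSpecResidueField w).inv.left ≫ (specRingHomι (closureValuationSubring (w.adicCompletion F)) (toClosureValuationSubring w) (IsLocalRing.residue (closureValuationSubring (w.adicCompletion F)))).left)).map ζ ≫ (I.univ.fibreBaseChangeIso (pullback.fst (𝓜.localise w).total.hom (specResidueField w)) ((𝓜.localise w).geomReductionMap (thickeningLift e (S.M.obj Kc) y'')).left ≪≫ I.univ.fibreCongrPtIso (((𝓜.localise w).left_geomReductionMap_comp_fst (thickeningLift e (S.M.obj Kc) y'')).trans (Category.assoc _ _ _).symm) ≪≫ (I.univ.fibreBaseChangeIso (extendPoint (closureValuationSubring (w.adicCompletion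 F)) (toClosureValuationSubring w) (𝓜.localise w).total ((𝓜.localise w).modelPointsEquiv.symm (thickeningLift e (S.M.obj Kc) y''))).left ((geomClosedPointIsoSpecResidueField w).inv.left ≫ (specRingHomι (closureValuationSubring (w.adicCompletion F)) (toClosureValuationSubring w) (IsLocalRing.residue (closureValuationSubring (w.adicCompletion F)))).left)).symm).inv.hom.hom.hom) ≫ cbar) =
            ((Over.pullback ((geomClosedPointIsoSpecResidueField w).inv.left ≫ (specRingHomι (closureValuationSubring (w.adicCompletion F)) (toClosureValuationSubring w) (IsLocalRing.residue (closureValuationSubring (w.adicCompletion F)))).left)).map incl ≫ (I.univ.fibreBaseChangeIso (pullback.fst (𝓜.localise w).total.hom (specResidueField w)) ((𝓜.localise w).geomReductionMap (thickeningLift e (S.M.obj Kc) y)).left ≪≫ I.univ.fibreCongrPtIso (((𝓜.localise w).left_geomReductionMap_comp_fst (thickeningLift e (S.M.obj Kc) y)).trans (Category.assoc _ _ _).symm) ≪≫ (I.univ.fibreBaseChangeIso (extendPoint (closureValuationSubring (w.adicCompletion F)) (toClosureValuationSubring w) (𝓜.localise w).total ((𝓜.localise w).modelPointsEquiv.symm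 (thickeningLift e (S.M.obj Kc) y))).left ((geomClosedPointIsoSpecResidueField w).inv.left ≫ (specRingHomι (closureValuationSubring (w.adicCompletion F)) (toClosureValuationSubring w) (IsLocalRing.residue (closureValuationSubring (w.adicCompletion F)))).left)).symm).inv.hom.hom.hom) ≫ ψ))
    -- the UPSTAIRS image factorisation through `V(eL Lb)` (a morphism; from § Jφ's membership law by (U1))
    (himgΩ : haveI := isMonHom_transR I y; haveI := isMonHom_transR I y''; haveI := isAffine_layerΩ_left I y''
      ∃ m₀ : layerΩ I y ⟶ specOver (AlgebraicClosure (w.adicCompletion F)) (Alg (layerΩ I y'') ⧸ (eLOf I y'' Lb).1),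
        m₀ ≫ quotIncl (layerΩ I y'') (eLOf I y'' Lb).1 ≫ (Over.pullback (sΩ w)).map (ιR I y'') ≫ (isoGenericOf I y'').inv ≫ c =
          (Over.pullback (sΩ w)).map (ιR I y) ≫ (isoGenericOf I y).inv ≫ q)
    -- (t1) the flat closure of `V(eL Lb)` through the model cover leg is a CLOSED immersion (discharge: ★ `isClosedImmersion_subpin_comp_cover_left`, (T1-LS))
    (hclosed : haveI := isMonHom_transR I y''; haveI := isAffine_layerR_left I y''; haveI := isAffine_layerΩ_left I y''
      IsClosedImmersion ((quotIncl (layerR I y'') (((eLOf I y'' Lb).1.map (algBaseChangeEquiv (AlgebraicClosure (w.adicCompletion F)) (layerR I y''))).comap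
          (Algebra.TensorProduct.includeRight : Alg (layerR I y'') →ₐ[↥(closureValuationSubring (w.adicCompletion F))]
            TensorProduct ↥(closureValuationSubring (w.adicCompletion F)) (AlgebraicClosure (w.adicCompletion F)) (Alg (layerR I y'')))) ≫ ιR I y'') ≫ cR).left) :
    letI := (𝔡 (red₀Of S Kc 𝓜 w h𝓨 e y)).grp₀
    haveI := (𝔡 (red₀Of S Kc 𝓜 w h𝓨 e y)).aff₀
    letI := (𝔡 (red₀Of S Kc 𝓜 w h𝓨 e y'')).grp₀
    haveI := (𝔡 (red₀Of S Kc 𝓜 w h𝓨 e y'')).aff₀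
    ∀ ⦃T : SchemeOver (geomResidueField w)⦄ (t : T ⟶ (𝔡 (red₀Of S Kc 𝓜 w h𝓨 e y)).G₀),
      ∃ s : T ⟶ specOver (geomResidueField w) (Alg (𝔡 (red₀Of S Kc 𝓜 w h𝓨 e y'')).G₀ ⧸ (spGeoOf I 𝔡 y'' Lb).1),
        s ≫ quotIncl (𝔡 (red₀Of S Kc 𝓜 w h𝓨 e y'')).G₀ (spGeoOf I 𝔡 y'' Lb).1 ≫ (𝔡 (red₀Of S Kc 𝓜 w h𝓨 e y'')).ι₀G ≫ cbar =
          t ≫ (𝔡 (red₀Of S Kc 𝓜 w h𝓨 e y)).ι₀G ≫ ψ := by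
  letI := (𝔡 (red₀Of S Kc 𝓜 w h𝓨 e y)).grp₀
  haveI := (𝔡 (red₀Of S Kc 𝓜 w h𝓨 e y)).aff₀
  letI := (𝔡 (red₀Of S Kc 𝓜 w h𝓨 e y'')).grp₀
  haveI := (𝔡 (red₀Of S Kc 𝓜 w h𝓨 e y'')).aff₀
  letI := (toGeomκ w).toAlgebra
  haveI : IsProper (𝓜.localise w).total.hom := h𝓨.2
  haveI := isMonHom_transR I y
  haveI := isMonHom_transR I y''
  haveI := isAffine_layerR_left I y''
  haveI := isAffine_layerΩ_left I y''
  -- §1: the generic premiss on the closure, three-piece currency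
  have h1 := imgRowHypΩ_of_imgLine I y y'' Lb q c hσΩ hσΩ'' himgΩ
  -- the (IMG-gen) row at `𝒦 := layerR I y` (flat), `𝒵 := V((eL Lb)^sat)`, the side condition handed over as a term
  haveI := flat_layerR_hom I y
  have h3 := @hIMG (layerR I y) (ιR I y) inferInstance
    (specOver ↥(closureValuationSubring (w.adicCompletion F)) (Alg (layerR I y'') ⧸ satOf I y'' Lb)) (closureInclOf I y'' Lb) hclosed h1
  -- §T: move the special base point `s̄_R ↦ sκ w` (`liftOf = extendPoint …`, `red₀Of = geomReductionMap …` definitionally)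
  have h4 := exists_comp_threePiece_inv_of_eq₂ (s₂ := sκ w) (pullback.fst (𝓜.localise w).total.hom (specResidueField w))
    (red₀Of S Kc 𝓜 w h𝓨 e y).left (red₀Of S Kc 𝓜 w h𝓨 e y'').left (liftOf S Kc 𝓜 w h𝓨 e y).left (liftOf S Kc 𝓜 w h𝓨 e y'').left I.univ
    (specMap_toGeomκ_eq w).symm
    (((𝓜.localise w).left_geomReductionMap_comp_fst (thickeningLift e (S.M.obj Kc) y)).trans (Category.assoc _ _ _).symm)
    (left_red₀Of_comp_specialι_eq S Kc 𝓜 w h𝓨 e y)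
    (((𝓜.localise w).left_geomReductionMap_comp_fst (thickeningLift e (S.M.obj Kc) y'')).trans (Category.assoc _ _ _).symm)
    (left_red₀Of_comp_specialι_eq S Kc 𝓜 w h𝓨 e y'')
    (ιR I y) (closureInclOf I y'' Lb) ψ cbar h3
  -- (F1) at the special points, then §2
  rw [← hσκ, ← hσκ''] at h4
  exact fun T t => himg_of_imgRowκ I 𝔡 y y'' Lb ψ cbar
    (exists_comp_quotIncl_spGeoOf_of_spIOf I 𝔡 y y'' Lb ψ cbar (exists_comp_quotIncl_spIOf_of_imgRowκ I y y'' Lb ψ cbar h4)) t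

end KillEngine

section ImgRowUp

set_option synthInstance.maxHeartbeats 100000

open Literature.AlgebraicGeometry.GroupSchemes (GroupSchemeKernel.ker GroupSchemeKernel.kerι)
open Literature.AlgebraicGeometry.GroupSchemes.AffineGroupScheme (quotIncl ptEquiv)
open Literature.AlgebraicGeometry.GroupSchemes.EtaleHomOfPoints (exists_hom_comp_quotIncl_comp_eq_of_points)

-- the frame of the D-line՚s `Letters` section VERBATIM
variable {F : Type} [Field F] [NumberField F] [IsCMField F] {ι₁ : F →+* ℂ}
    {Jstar : Matrix (Fin 2) (Fin 2) F}
    {K₀ : C5.OpenCompactSubgroup ↥(finAdelic ↥(maximalRealSubfield F) F (IsCMField.complexConj F) 2 Jstar)}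
    {S : RecordSystemGS F Jstar ι₁ K₀} {hU7ₛ : S.HeckeTranslateDefinedOver}
    {hJ : (Jstar.map (IsCMField.complexConj F))ᵀ = Jstar} {hJu : IsUnit Jstar}
    {Fi : Type} [Field Fi] [Algebra F Fi] {Kc : C5.SmallLevel K₀} {G : Type} [Group G]
    {𝓜 : IntegralModel (𝓞 F) F ((thickening F Fi).obj (S.M.obj Kc))}
    {w : HeightOneSpectrum (𝓞 F)} {hw : (IsCMField.complexConj F) • w ≠ w} {h𝓨 : (𝓜.localise w).IsSmoothProper 1}
    {θ : ActionOver (𝓜.localise w).total.hom ((Fi ≃ₐ[F] Fi) × G)}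
    {e : Fi →ₐ[F] AlgebraicClosure (w.adicCompletion F)}

variable (I : RGDInputsAt F ι₁ Jstar K₀ S hU7ₛ hJ hJu Fi Kc G 𝓜 w hw h𝓨 θ e)

/-! ### (U1′) rows-free: the morphism from the points-level lift -/

set_option maxHeartbeats 400000 in
open scoped MonObj CategoryTheory.Obj in
set_option backward.isDefEq.respectTransparency false in
/-- **(U1′) THE UPSTAIRS IMAGE FACTORISATION AS A MORPHISM, FROM THE POINTS-LEVEL LIFT.**  For legs `A_y —q→ B ←c— A_{y″}`, a line `Lb : LineOf I y″`, the LIFT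
`hlift` (every `Ω̄`-point `x` of `layerΩ I y`, read in `A_y` through `(ιR)_Ω̄ ≫ σΩ⁻¹` and pushed along `q`, equals `c P″` for some `P″ ∈ Lb`) and `hLb''` (every member
of `Lb` is the reading of an `Ω̄`-point of `layerΩ I y″`), there is a MORPHISM `m₀ : layerΩ I y → V(eL Lb)` with
`m₀ ≫ V(eL Lb) ↪ layerΩ I y″ ↪ A_{y″} —c→ B = layerΩ I y ↪ A_y —q→ B`: the generic layer is finite ÉTALE over the algebraically closed `Ω̄` (`isFinite_layerΩ_hom`,
`etale_layerΩ_hom`), so ★ `exists_hom_comp_quotIncl_comp_eq_of_points` builds `m₀` from the partner function `x ↦ x″` (the partner kills `eL Lb` by the served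
membership law `eLOf_le_ker_iff`). [cite: Tate1997FiniteFlatGroupSchemes, (3.7)] [cite: GortzWedhorn2023, §(27.2) (27.2.1) (p. 607)] [cite: Liu2021, Prop. D.8 (1)(2) p. 135] -/
theorem exists_layerΩ_hom_of_lift (y y'' : AlgPoints (S.M.obj Kc) (AlgebraicClosure (w.adicCompletion F))) (Lb : LineOf I y'')
    {B : AbelianSchemeOver (Spec (.of (AlgebraicClosure (w.adicCompletion F))))}
    (q : (schΩOf S Kc 𝓜 w e I.univ y).X ⟶ B.X) (c : (schΩOf S Kc 𝓜 w e I.univ y'').X ⟶ B.X)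
    -- the points-level LIFT through `c` into the line
    (hlift : ∀ x : specOver (AlgebraicClosure (w.adicCompletion F)) (AlgebraicClosure (w.adicCompletion F)) ⟶ layerΩ I y,
      ∃ P'' ∈ Lb.1,
        (AlgPoints.map c P'' : B.toAffine.toAbelianVariety.Points (AlgebraicClosure (w.adicCompletion F))) =
          AlgPoints.map q (x ≫ (Over.pullback (sΩ w)).map (ιR I y) ≫ (isoGenericOf I y).inv :
            (fibreΩOf S Kc 𝓜 w e I.univ y).Points (AlgebraicClosure (w.adicCompletion F))))
    -- members of the line are read from points of the layer at `y″`
    (hLb'' : ∀ P'' ∈ Lb.1,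
      ∃ x'' : specOver (AlgebraicClosure (w.adicCompletion F)) (AlgebraicClosure (w.adicCompletion F)) ⟶ layerΩ I y'',
        x'' ≫ (Over.pullback (sΩ w)).map (ιR I y'') ≫ (isoGenericOf I y'').inv = P'') :
    haveI := isMonHom_transR I y
    haveI := isMonHom_transR I y''
    haveI := isAffine_layerΩ_left I y''
    ∃ m₀ : layerΩ I y ⟶ specOver (AlgebraicClosure (w.adicCompletion F)) (Alg (layerΩ I y'') ⧸ (eLOf I y'' Lb).1),
      m₀ ≫ quotIncl (layerΩ I y'') (eLOf I y'' Lb).1 ≫ (Over.pullback (sΩ w)).map (ιR I y'') ≫ (isoGenericOf I y'').inv ≫ c =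
        (Over.pullback (sΩ w)).map (ιR I y) ≫ (isoGenericOf I y).inv ≫ q := by
  haveI := isMonHom_transR I y
  haveI := isMonHom_transR I y''
  haveI := isAffine_layerΩ_left I y''
  haveI := isFinite_layerΩ_hom I y
  haveI := etale_layerΩ_hom I y
  -- floor (a): the finite ÉTALE `layerΩ I y` maps to `V(eL Lb)` over the legs as soon as every point has a partner killing `eL Lb`
  refine exists_hom_comp_quotIncl_comp_eq_of_points (layerΩ I y) (layerΩ I y'') (eLOf I y'' Lb).1
    ((Over.pullback (sΩ w)).map (ιR I y'') ≫ (isoGenericOf I y'').inv ≫ c)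
    ((Over.pullback (sΩ w)).map (ιR I y) ≫ (isoGenericOf I y).inv ≫ q) fun x => ?_
  obtain ⟨P'', hP''L, hc⟩ := hlift x
  obtain ⟨x'', hx''⟩ := hLb'' P'' hP''L
  subst hx''
  -- the partner `x″` kills `eL Lb` (served membership law) and reads `c P″ = q P`
  refine ⟨x'', (eLOf_le_ker_iff I y'' Lb x'').2 hP''L, ?_⟩
  have hc' : (x'' ≫ (Over.pullback (sΩ w)).map (ιR I y'') ≫ (isoGenericOf I y'').inv) ≫ c =
      (x ≫ (Over.pullback (sΩ w)).map (ιR I y) ≫ (isoGenericOf I y).inv) ≫ q := hc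
  simpa only [Category.assoc] using hc'

/-! ### (U1) § Jφ's currency: the membership law + the layer's point laws + the three roof rows -/

set_option maxHeartbeats 400000 in
open scoped MonObj CategoryTheory.Obj in
set_option backward.isDefEq.respectTransparency false in
/-- **(U1) THE UPSTAIRS IMAGE FACTORISATION AS A MORPHISM.**  For the roof legs `A_y —q→ B ←c— A_{y″}` with the rows (r2) `Ker c(Ω̄) = A_{y″}[𝔭_w]`, `c` onto on
`Ω̄`-points, (r4) common intertwiners, and the image line `Lb : LineOf I y″` with § Jφ's membership law `hLb` (B-p08 (g35) `mem_imgLineOfRoof_iff` text: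
`P″ ∈ Lb ↔ P″ ∈ A_{y″}[𝔭_{c•w}](Ω̄) ∧ ∃ P ∈ A_y[𝔭_{c•w}](Ω̄), c P″ = q P`) and the layer's point laws `hlayer` (every `Ω̄`-point of `layerΩ I y`, read in `A_y` through `σΩ⁻¹`,
is `𝔭_{c•w}`-torsion) ∕ `hlayer''` (a `𝔭_{c•w}`-torsion `Ω̄`-point of `A_{y″}` is read from a point of `layerΩ I y″`) — LS §1c-0 `exists_comp_pullback_map_ιR_iff` —, there is a
MORPHISM `m₀ : layerΩ I y → V(eL Lb)` over the legs: `m₀ ≫ V(eL Lb) ↪ layerΩ I y″ ↪ A_{y″} —c→ B = layerΩ I y ↪ A_y —q→ B` — the `himgΩ` binder of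
`himg_spGeoOf_of_imgLine`.  PROOF = (U1′) with the LIFT ★ `exists_torsion_map_eq_map_of_torsion` (`c` onto, `Ker c = A″[𝔭_w]`, `𝔭_w + 𝔭_{c•w} = 𝒪` from `hw`, the
intertwiners): the lift `P″` of `q P` is `𝔭_{c•w}`-torsion with `c P″ = q P`, hence a member of `Lb` (`hLb` «←»).
[cite: StacksProject, Tag 00U3] [cite: Tate1997FiniteFlatGroupSchemes, (3.7)] [cite: Liu2021, Prop. D.8 (1)(2) p. 135] [cite: MumfordAV1970, §7 Thm. 4 (p. 72)] -/
theorem exists_layerΩ_hom_of_imgLine (y y'' : AlgPoints (S.M.obj Kc) (AlgebraicClosure (w.adicCompletion F))) (Lb : LineOf I y'')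
    {B : AbelianSchemeOver (Spec (.of (AlgebraicClosure (w.adicCompletion F))))}
    (q : (schΩOf S Kc 𝓜 w e I.univ y).X ⟶ B.X) [IsMonHom q] (c : (schΩOf S Kc 𝓜 w e I.univ y'').X ⟶ B.X) [IsMonHom c]
    -- § Jφ's membership law (B-p08 (g35) `exists_imgLine_of_roofLegs`, unfolded by `mem_imgLineOfRoof_iff`)
    (hLb : ∀ P'' : (fibreΩOf S Kc 𝓜 w e I.univ y'').Points (AlgebraicClosure (w.adicCompletion F)),
      P'' ∈ Lb.1 ↔
        IsIdealTorsionΩ S Kc 𝓜 w e I.univ I.act y'' ((IsCMField.complexConj F) • w).asIdeal P'' ∧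
          ∃ P : (fibreΩOf S Kc 𝓜 w e I.univ y).Points (AlgebraicClosure (w.adicCompletion F)),
            IsIdealTorsionΩ S Kc 𝓜 w e I.univ I.act y ((IsCMField.complexConj F) • w).asIdeal P ∧
              (AlgPoints.map c P'' : B.toAffine.toAbelianVariety.Points (AlgebraicClosure (w.adicCompletion F))) = AlgPoints.map q P)
    -- the layer's point law at `y` (LS §1c-0 `exists_comp_pullback_map_ιR_iff` «→», read through `actΩ_comp_isoGenericOf_hom`)
    (hlayer : haveI := isMonHom_transR I y
      ∀ x : specOver (AlgebraicClosure (w.adicCompletion F)) (AlgebraicClosure (w.adicCompletion F)) ⟶ layerΩ I y,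
        IsIdealTorsionΩ S Kc 𝓜 w e I.univ I.act y ((IsCMField.complexConj F) • w).asIdeal
          (x ≫ (Over.pullback (sΩ w)).map (ιR I y) ≫ (isoGenericOf I y).inv :
            (fibreΩOf S Kc 𝓜 w e I.univ y).Points (AlgebraicClosure (w.adicCompletion F))))
    -- its converse at `y″` (LS §1c-0 `exists_comp_pullback_map_ιR_iff` «←»)
    (hlayer'' : haveI := isMonHom_transR I y''
      ∀ P'' : (fibreΩOf S Kc 𝓜 w e I.univ y'').Points (AlgebraicClosure (w.adicCompletion F)),
        IsIdealTorsionΩ S Kc 𝓜 w e I.univ I.act y'' ((IsCMField.complexConj F) • w).asIdeal P'' →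
          ∃ x'' : specOver (AlgebraicClosure (w.adicCompletion F)) (AlgebraicClosure (w.adicCompletion F)) ⟶ layerΩ I y'',
            x'' ≫ (Over.pullback (sΩ w)).map (ιR I y'') ≫ (isoGenericOf I y'').inv = P'')
    -- (r2) `Ker c(Ω̄) = A_{y″}[𝔭_w]` (B-p08 `imgLineOfRoof_isLine` `h2` text)
    (h2 : ∀ P : (fibreΩOf S Kc 𝓜 w e I.univ y'').Points (AlgebraicClosure (w.adicCompletion F)),
      (AlgPoints.map c P : B.toAffine.toAbelianVariety.Points (AlgebraicClosure (w.adicCompletion F))) = 1 ↔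
        IsIdealTorsionΩ S Kc 𝓜 w e I.univ I.act y'' w.asIdeal P)
    -- `c` is onto on points (B-p08 `h2s` text)
    (h2s : Function.Surjective c.left.base)
    -- (r4) common intertwiners of the legs (B-p08 `h4` text)
    (h4 : ∀ a : 𝓞 F, ∃ b : B.X ⟶ B.X,
      (actΩOf S Kc 𝓜 w e I.univ I.act a y).hom.hom.hom ≫ q = q ≫ b ∧ (actΩOf S Kc 𝓜 w e I.univ I.act a y'').hom.hom.hom ≫ c = c ≫ b) :
    haveI := isMonHom_transR I y
    haveI := isMonHom_transR I y''
    haveI := isAffine_layerΩ_left I y''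
    ∃ m₀ : layerΩ I y ⟶ specOver (AlgebraicClosure (w.adicCompletion F)) (Alg (layerΩ I y'') ⧸ (eLOf I y'' Lb).1),
      m₀ ≫ quotIncl (layerΩ I y'') (eLOf I y'' Lb).1 ≫ (Over.pullback (sΩ w)).map (ιR I y'') ≫ (isoGenericOf I y'').inv ≫ c =
        (Over.pullback (sΩ w)).map (ιR I y) ≫ (isoGenericOf I y).inv ≫ q := by
  haveI := isMonHom_transR I y
  haveI := isMonHom_transR I y''
  haveI := isAffine_layerΩ_left I y''
  -- `𝔭_w + 𝔭_{c•w} = 𝒪_F`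
  have hne : w.asIdeal ≠ ((IsCMField.complexConj F) • w).asIdeal := fun h => hw (HeightOneSpectrum.ext h.symm)
  have h𝔭𝔞 : w.asIdeal ⊔ ((IsCMField.complexConj F) • w).asIdeal = ⊤ :=
    Ideal.IsMaximal.coprime_of_ne w.isMaximal ((IsCMField.complexConj F) • w).isMaximal hne
  -- (U1′) with the torsion LIFT through `c` as the partner function; members of `Lb` are torsion (`hLb` «→»), hence read from the layer (`hlayer''`)
  refine exists_layerΩ_hom_of_lift I y y'' Lb q c (fun x => ?_) (fun P'' hP'' => hlayer'' P'' ((hLb P'').1 hP'').1)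
  obtain ⟨P'', hP''t, hP''c⟩ :=
    exists_torsion_map_eq_map_of_torsion (actΩROf I y) (actΩROf I y'') q c h𝔭𝔞 h2 h2s h4 (hlayer x)
  exact ⟨P'', (hLb P'').2 ⟨hP''t, _, hlayer x, hP''c⟩, hP''c⟩

/-! ### (U1″) the layer's point laws DISCHARGED on the served LS leaflet (§1c-0 `exists_comp_pullback_map_ιR_iff`, (σ3) `actΩ_comp_isoGenericOf_hom`) -/

set_option maxHeartbeats 400000 in
open scoped MonObj CategoryTheory.Obj in
set_option backward.isDefEq.respectTransparency false in
/-- **THE LAYER'S POINT LAW AT `y`, READ IN `A_y` (any `T`)**: a `T`-point of `layerΩ I y`, read in `A_y = schΩOf … y` through `(ιR)_Ω̄ ≫ σΩ⁻¹`, is killed by every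
`ι(a)_y`, `a ∈ 𝔭_{c•w}` — LS §1c-0 `exists_comp_pullback_map_ιR_iff` «→» moved along the equivariant (σ3) `isoGenericOf` (`actΩ_comp_isoGenericOf_hom`, cancel the
monomorphism `σΩ`). [cite: Conrad2004GrossZagier, §7 (Thm. 7.5)] [cite: Tate1997FiniteFlatGroupSchemes, (3.7)] -/
theorem comp_ιR_comp_isoGenericOf_inv_comp_actΩ_eq_one (y : AlgPoints (S.M.obj Kc) (AlgebraicClosure (w.adicCompletion F)))
    {T : Over (Spec (.of (AlgebraicClosure (w.adicCompletion F))))} (x : T ⟶ layerΩ I y)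
    (a : 𝓞 F) (ha : a ∈ ((IsCMField.complexConj F) • w).asIdeal) :
    (x ≫ (Over.pullback (sΩ w)).map (ιR I y) ≫ (isoGenericOf I y).inv) ≫ (actΩOf S Kc 𝓜 w e I.univ I.act a y).hom.hom.hom = 1 := by
  haveI := isMonHom_isoGenericOf_hom I y
  have h := (exists_comp_pullback_map_ιR_iff I y (x ≫ (Over.pullback (sΩ w)).map (ιR I y))).1 ⟨x, rfl⟩ a ha
  rw [← cancel_mono (isoGenericOf I y).hom, MonObj.one_comp]
  simp only [Category.assoc]
  rw [actΩ_comp_isoGenericOf_hom, Iso.inv_hom_id_assoc, ← Category.assoc]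
  exact h

set_option maxHeartbeats 400000 in
open scoped MonObj CategoryTheory.Obj in
set_option backward.isDefEq.respectTransparency false in
/-- **… AND ITS CONVERSE (Ω̄-points)**: an `Ω̄`-point of `A_y` killed by `ι(𝔭_{c•w})_y` is the reading of a point of `layerΩ I y` — LS §1c-0 `exists_comp_pullback_map_ιR_iff` «←»
at `P ≫ σΩ`. [cite: Conrad2004GrossZagier, §7 (Thm. 7.5)] [cite: Tate1997FiniteFlatGroupSchemes, (3.7)] -/
theorem exists_comp_ιR_comp_isoGenericOf_inv_eq_of_isIdealTorsionΩ (y : AlgPoints (S.M.obj Kc) (AlgebraicClosure (w.adicCompletion F)))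
    (P : (fibreΩOf S Kc 𝓜 w e I.univ y).Points (AlgebraicClosure (w.adicCompletion F)))
    (hP : IsIdealTorsionΩ S Kc 𝓜 w e I.univ I.act y ((IsCMField.complexConj F) • w).asIdeal P) :
    ∃ x : specOver (AlgebraicClosure (w.adicCompletion F)) (AlgebraicClosure (w.adicCompletion F)) ⟶ layerΩ I y,
      x ≫ (Over.pullback (sΩ w)).map (ιR I y) ≫ (isoGenericOf I y).inv = P := by
  haveI := isMonHom_isoGenericOf_hom I y
  have h : ∀ a ∈ ((IsCMField.complexConj F) • w).asIdeal,
      ((P : specOver (AlgebraicClosure (w.adicCompletion F)) (AlgebraicClosure (w.adicCompletion F)) ⟶ (schΩOf S Kc 𝓜 w e I.univ y).X) ≫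
          (isoGenericOf I y).hom) ≫ ((actFamOf I y).baseChange (sΩ w)).i a = 1 := fun a ha => by
    have hPa : (P : specOver (AlgebraicClosure (w.adicCompletion F)) (AlgebraicClosure (w.adicCompletion F)) ⟶ (schΩOf S Kc 𝓜 w e I.univ y).X) ≫
        (actΩOf S Kc 𝓜 w e I.univ I.act a y).hom.hom.hom = 1 := hP a ha
    rw [Category.assoc, ← actΩ_comp_isoGenericOf_hom, ← Category.assoc, hPa, MonObj.one_comp]
  obtain ⟨s, hs⟩ := (exists_comp_pullback_map_ιR_iff I y _).2 h
  exact ⟨s, by rw [← Category.assoc, hs, Category.assoc, Iso.hom_inv_id, Category.comp_id]⟩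

set_option maxHeartbeats 400000 in
open scoped MonObj CategoryTheory.Obj in
set_option backward.isDefEq.respectTransparency false in
/-- **(U1″) THE UPSTAIRS IMAGE FACTORISATION AS A MORPHISM — ROOF ROWS ONLY.**  (U1) with the layer's point laws `hlayer`∕`hlayer''` DISCHARGED on the served LS
leaflet (`comp_ιR_comp_isoGenericOf_inv_comp_actΩ_eq_one`, `exists_comp_ιR_comp_isoGenericOf_inv_eq_of_isIdealTorsionΩ`): from § Jφ's membership law `hLb` of the
image line and the three roof rows (r2) `Ker c(Ω̄) = A_{y″}[𝔭_w]`, `c` onto, (r4) common intertwiners — the (ρ1𝒞) legs' rows —, the MORPHISM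
`m₀ : layerΩ I y → V(eL Lb)` over the legs. [cite: Liu2021, Prop. D.8 (1)(2) p. 135] [cite: Tate1997FiniteFlatGroupSchemes, (3.7)] [cite: MumfordAV1970, §7 Thm. 4 (p. 72)] -/
theorem exists_layerΩ_hom_of_roofRows (y y'' : AlgPoints (S.M.obj Kc) (AlgebraicClosure (w.adicCompletion F))) (Lb : LineOf I y'')
    {B : AbelianSchemeOver (Spec (.of (AlgebraicClosure (w.adicCompletion F))))}
    (q : (schΩOf S Kc 𝓜 w e I.univ y).X ⟶ B.X) [IsMonHom q] (c : (schΩOf S Kc 𝓜 w e I.univ y'').X ⟶ B.X) [IsMonHom c]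
    -- § Jφ's membership law (B-p08 `mem_imgLineOfRoof_iff` text)
    (hLb : ∀ P'' : (fibreΩOf S Kc 𝓜 w e I.univ y'').Points (AlgebraicClosure (w.adicCompletion F)),
      P'' ∈ Lb.1 ↔
        IsIdealTorsionΩ S Kc 𝓜 w e I.univ I.act y'' ((IsCMField.complexConj F) • w).asIdeal P'' ∧
          ∃ P : (fibreΩOf S Kc 𝓜 w e I.univ y).Points (AlgebraicClosure (w.adicCompletion F)),
            IsIdealTorsionΩ S Kc 𝓜 w e I.univ I.act y ((IsCMField.complexConj F) • w).asIdeal P ∧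
              (AlgPoints.map c P'' : B.toAffine.toAbelianVariety.Points (AlgebraicClosure (w.adicCompletion F))) = AlgPoints.map q P)
    -- (r2) `Ker c(Ω̄) = A_{y″}[𝔭_w]` (B-p08 `imgLineOfRoof_isLine` `h2` text)
    (h2 : ∀ P : (fibreΩOf S Kc 𝓜 w e I.univ y'').Points (AlgebraicClosure (w.adicCompletion F)),
      (AlgPoints.map c P : B.toAffine.toAbelianVariety.Points (AlgebraicClosure (w.adicCompletion F))) = 1 ↔
        IsIdealTorsionΩ S Kc 𝓜 w e I.univ I.act y'' w.asIdeal P)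
    -- `c` is onto on points (B-p08 `h2s` text)
    (h2s : Function.Surjective c.left.base)
    -- (r4) common intertwiners of the legs (B-p08 `h4` text)
    (h4 : ∀ a : 𝓞 F, ∃ b : B.X ⟶ B.X,
      (actΩOf S Kc 𝓜 w e I.univ I.act a y).hom.hom.hom ≫ q = q ≫ b ∧ (actΩOf S Kc 𝓜 w e I.univ I.act a y'').hom.hom.hom ≫ c = c ≫ b) :
    haveI := isMonHom_transR I y
    haveI := isMonHom_transR I y''
    haveI := isAffine_layerΩ_left I y''
    ∃ m₀ : layerΩ I y ⟶ specOver (AlgebraicClosure (w.adicCompletion F)) (Alg (layerΩ I y'') ⧸ (eLOf I y'' Lb).1),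
      m₀ ≫ quotIncl (layerΩ I y'') (eLOf I y'' Lb).1 ≫ (Over.pullback (sΩ w)).map (ιR I y'') ≫ (isoGenericOf I y'').inv ≫ c =
        (Over.pullback (sΩ w)).map (ιR I y) ≫ (isoGenericOf I y).inv ≫ q :=
  exists_layerΩ_hom_of_imgLine I y y'' Lb q c hLb (fun x a ha => comp_ιR_comp_isoGenericOf_inv_comp_actΩ_eq_one I y x a ha)
    (fun P'' hP'' => exists_comp_ιR_comp_isoGenericOf_inv_eq_of_isIdealTorsionΩ I y'' P'' hP'') h2 h2s h4

/-! ### (T1-LS) the `hclosed` side condition of `himg_spGeoOf_of_imgLine` at the MODEL cover leg `c̄_R = ψ_P ×_𝓨 ỹ″` -/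

end ImgRowUp

end Summit.HodgeConjecture.HodgeConjecture.Cruxes.HLiu418.F0P6aLineSpecialisation

end
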